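import Mathlib
import Literature.Analysis.FluidPDE.VectorCalculus

/-!
# (N1) ROW–TRACE SPLITTING OF THE FROBENIUS NORM (nsreg-p2 g36 ROUND-46 v1.1 §7, plate t49-N1; text `r46/Sketch46b.lean`
sha16 642a48bf5342366b, Prop `NsregP2.R46b.FrobeniusRowTrace`; seeds R47-1)

Width piece for crux `EulerZoomLiouville.PowerGaugeEulerLiouville` (stmt-NavierStokesRegularity-19832), by name under LEAD 19832
(ns-typeII-p2); seat ns-sfl-p1 g7, `--supports stmt-NavierStokesRegularity-19832 --as helper`.  Text binder-for-binder (`E3`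
spelled out).

For a linear map `L` of `ℝ³` with matrix entries `M i j = ⟪L (b i), b j⟫` in an orthonormal basis `b` and a distinguished index
`k`: `(1 − ε²) · Σ_{i ≠ k} M i k ² + ε · tr(L ∘ L) ≤ ‖L‖_F²` for every `0 < ε ≤ 1`.
Proof: `‖L‖_F² = Σ_{i,j} M i j ²` (`frobeniusNormSq_eq_sum` + Parseval), `tr(L∘L) = Σ_{i,j} M i j · M j i`
(`LinearMap.trace_eq_sum_inner` + `OrthonormalBasis.sum_repr'`); then termwise: `2ε M i k M k i ≤ M k i ² + ε² M i k ²` for the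
pairs meeting the column `k`, `2ε M i j M j i ≤ ε(M i j ² + M j i ²) ≤ M i j ² + M j i ²` for the other pair, `ε M i i ² ≤ M i i ²`
(`rowTrace_matrix`, `fin_cases k` + `linarith`).
Why it matters (R46 §7): slice CAPACITY only needs the column `Σ_{i≠k} M i k ² = |∇_⊥ V_e|²`, the pressure source is
`tr((DV)²) = −ΔP`; (N1) charges them to disjoint shares of the Frobenius enstrophy.

HONEST FRAMING: finite-dimensional linear algebra; nothing here proves the crux E (19832 OPEN), any door Target, or any
Navier–Stokes statement. [folklore]
-/

noncomputable section

open Finset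
open scoped RealInnerProductSpace

set_option linter.dupNamespace false

namespace Summit.NavierStokesRegularity.NavierStokesRegularity.Theorems.PowerGaugeEulerLiouville.Condenser

open Literature.Analysis.FluidPDE

/-- The matrix form of (N1): for `M : Fin 3 → Fin 3 → ℝ`, `k : Fin 3`, `0 < ε ≤ 1`,
`(1 − ε²) Σ_{i ≠ k} M i k ² + ε Σ_{i,j} M i j M j i ≤ Σ_{i,j} M i j ²`. [folklore] -/
theorem rowTrace_matrix (M : Fin 3 → Fin 3 → ℝ) (k : Fin 3) {ε : ℝ} (hε : 0 < ε) (hε1 : ε ≤ 1) :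
    (1 - ε ^ 2) * (∑ i ∈ univ.erase k, M i k ^ 2) + ε * (∑ i, ∑ j, M i j * M j i) ≤ ∑ i, ∑ j, M i j ^ 2 := by
  have hS : ∑ i ∈ univ.erase k, M i k ^ 2 = (∑ i, M i k ^ 2) - M k k ^ 2 := by
    have h := Finset.add_sum_erase univ (fun i => M i k ^ 2) (mem_univ k)
    linarith
  rw [hS]
  have h1 : 0 ≤ 1 - ε := by linarith
  have a01 := sq_nonneg (M 0 1 - ε * M 1 0)
  have a10 := sq_nonneg (M 1 0 - ε * M 0 1)
  have a02 := sq_nonneg (M 0 2 - ε * M 2 0)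
  have a20 := sq_nonneg (M 2 0 - ε * M 0 2)
  have a12 := sq_nonneg (M 1 2 - ε * M 2 1)
  have a21 := sq_nonneg (M 2 1 - ε * M 1 2)
  have g01 := mul_nonneg hε.le (sq_nonneg (M 0 1 - M 1 0))
  have g02 := mul_nonneg hε.le (sq_nonneg (M 0 2 - M 2 0))
  have g12 := mul_nonneg hε.le (sq_nonneg (M 1 2 - M 2 1))
  have d00 := mul_nonneg h1 (sq_nonneg (M 0 0))
  have d01 := mul_nonneg h1 (sq_nonneg (M 0 1))
  have d02 := mul_nonneg h1 (sq_nonneg (M 0 2))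
  have d10 := mul_nonneg h1 (sq_nonneg (M 1 0))
  have d11 := mul_nonneg h1 (sq_nonneg (M 1 1))
  have d12 := mul_nonneg h1 (sq_nonneg (M 1 2))
  have d20 := mul_nonneg h1 (sq_nonneg (M 2 0))
  have d21 := mul_nonneg h1 (sq_nonneg (M 2 1))
  have d22 := mul_nonneg h1 (sq_nonneg (M 2 2))
  obtain rfl | rfl | rfl : k = 0 ∨ k = 1 ∨ k = 2 := by fin_cases k <;> decide
  all_goals simp only [Fin.sum_univ_three, Fin.isValue]; linarith

/-- **(N1) `NsregP2.R46b.FrobeniusRowTrace`, binder-for-binder.**  See the module docstring. [folklore] -/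
theorem frobeniusRowTrace :
    ∀ (L : EuclideanSpace ℝ (Fin 3) →L[ℝ] EuclideanSpace ℝ (Fin 3)) (b : OrthonormalBasis (Fin 3) ℝ (EuclideanSpace ℝ (Fin 3)))
      (k : Fin 3) (ε : ℝ), 0 < ε → ε ≤ 1 →
      (1 - ε ^ 2) * (∑ i ∈ Finset.univ.erase k, ⟪L (b i), b k⟫ ^ 2)
          + ε * LinearMap.trace ℝ (EuclideanSpace ℝ (Fin 3))
              ((L : EuclideanSpace ℝ (Fin 3) →ₗ[ℝ] EuclideanSpace ℝ (Fin 3)) ∘ₗ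
                (L : EuclideanSpace ℝ (Fin 3) →ₗ[ℝ] EuclideanSpace ℝ (Fin 3)))
        ≤ frobeniusNormSq L := by
  intro L b k ε hε hε1
  -- `‖L‖_F² = Σ_{i,j} ⟪L bᵢ, bⱼ⟫²`
  have hF : frobeniusNormSq L = ∑ i, ∑ j, ⟪L (b i), b j⟫ ^ 2 := by
    rw [frobeniusNormSq_eq_sum b]
    exact Finset.sum_congr rfl fun i _ => (b.sum_sq_inner_left (L (b i))).symm
  -- `tr(L ∘ L) = Σ_{i,j} ⟪L bᵢ, bⱼ⟫ ⟪L bⱼ, bᵢ⟫`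
  have hT : LinearMap.trace ℝ (EuclideanSpace ℝ (Fin 3))
      ((L : EuclideanSpace ℝ (Fin 3) →ₗ[ℝ] EuclideanSpace ℝ (Fin 3)) ∘ₗ
        (L : EuclideanSpace ℝ (Fin 3) →ₗ[ℝ] EuclideanSpace ℝ (Fin 3))) =
      ∑ i, ∑ j, ⟪L (b i), b j⟫ * ⟪L (b j), b i⟫ := by
    rw [LinearMap.trace_eq_sum_inner _ b]
    refine Finset.sum_congr rfl fun i _ => ?_
    have hrepr : L (b i) = ∑ j, ⟪b j, L (b i)⟫ • b j := (b.sum_repr' _).symm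
    have h2 : L (L (b i)) = ∑ j, ⟪b j, L (b i)⟫ • L (b j) := by
      conv_lhs => rw [hrepr]
      simp only [map_sum, map_smul]
    simp only [LinearMap.coe_comp, Function.comp_apply, ContinuousLinearMap.coe_coe]
    rw [h2, inner_sum]
    refine Finset.sum_congr rfl fun j _ => ?_
    rw [real_inner_smul_right, real_inner_comm (L (b i)) (b j), real_inner_comm (L (b j)) (b i)]
  rw [hF, hT]
  exact rowTrace_matrix (fun i j => ⟪L (b i), b j⟫) k hε hε1

end Summit.NavierStokesRegularity.NavierStokesRegularity.Theorems.PowerGaugeEulerLiouville.Condenser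

end
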